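import Mathlib
import HarnessLib
import Literature.NumberTheory.Transcendental.LindemannWeierstrassProofs
import Summits.KontsevichZagierPeriods.Zeta5Search.MeasureHata
import Summits.KontsevichZagierPeriods.Zeta5Search.Denom.TwoTaleP15Saving

/-!
# TwoTaleP15Forms — Zudilin's two-tale forms at P15 and the conditional measure `μ(ζ(2)) ≤ 5.0496` (kernel packaging)

HONEST FRAMING: systematic search; no irrationality claim unless certified.

fam-denom (pub-zeta5), FAMILY.md §6 D16; the denominator/assembly side of fam-measure's T3 candidate
(`families/measure/FAMILY.md` §2.5, point **P15** `a = (13n+1, 11n+1, 9n+1, 15n+1)`, `b = (1, 2n+1, 4n+1, 26n+2)`).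
This file makes the candidate a KERNEL IMPLICATION with every input named and nothing hidden:

* the EXPLICIT forms of Zudilin's Proposition 1 (arXiv:1310.1526 §3) at P15, over `ℚ`: the pole coefficients
  `coefC n k = (−1)^{k+1} C(k−1,k−13n−1) C(k−2n−1,k−11n−1) C(k−4n−1,k−9n−1) C(11n,k−15n−1)` (`15n+1 ≤ k ≤ 26n+1`), the
  rational function `ratR`, the polynomial part `polyP = R − Σ C_k/(t+k)` evaluated at integers, its Newton
  coefficients `newtonA ℓ` at `t = 1 − a₂*`, `a₂* = 11n+1`, and
  `formQ n = (−1)^d Σ_k C_k`, `formP n = (−1)^d (Σ_k C_k Σ_{ℓ ≤ k−a₂*} ℓ⁻² − Σ_{ℓ ≤ d} (−1)^ℓ A_ℓ/(ℓ+1))`, `d = 16n−1`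
  (so `r_n = formQ n · ζ(2) − formP n` is Zudilin's `r(a,b)`; Prop. 1: `formQ n ∈ ℤ` by construction,
  `D₁₆ₙD₁₅ₙ · formP n ∈ ℤ`).  A 1:1 Python mirror (`code/denom/p15/leanmirror.py`) reproduces fam-measure's independently
  computed `q₁ = −9923952931816770`, `q₂`, `q₃` and `D₁₆ₙD₁₅ₙ pₙ ∈ ℤ`, `Φ̃ₙ ∣ D₁₆ₙD₁₅ₙ qₙ, D₁₆ₙD₁₅ₙ pₙ` for `n ≤ 8`;
* the three analytic INPUTS as named `Prop`s — `Inclusion` (Zudilin's Lemma 7 for `q` AND `p`, Lemma 8 via the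
  Remark-5 partner, and the "missing brick" (bmiss) at P15, for the explicit `Φ̃ₙ = savingProduct n` of
  `TwoTaleP15Saving`; proved at program level by fam-tele/eng-exactrec (`certs/tele/bmiss_P15/`), NOT in Lean),
  `Decay c` (`|r_n| ≤ e^{−cn}` eventually; model `C₀ = 29.10787127`, Zudilin's Lemma 6 shape — not certified),
  `CoeffRate C₁` (`(1/n) log|q_n| → C₁`; model `C₁ = 42.03361581` — not certified);
* **`exponentLE_of_normalisedForms`** (PROVED, abstract): Hata's lemma (tree: `ExponentLE.of_tendsto_log_coeff`) for
  forms `qₙξ − pₙ` renormalised by `Dₙ/Φₙ` (`Dₙqₙ = ΦₙBₙ`, `Dₙpₙ = ΦₙAₙ`): rates `C₁`, `c`, `δ = lim (1/n) log(Dₙ/Φₙ)` give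
  `μ(ξ) ≤ 1 + (C₁ + δ)/(c − δ)`;
* **`exponentLE_of_inputs`** (PROVED): `Inclusion → Decay c → CoeffRate C₁ → 31 − S < c → 0 < C₁ →
  ExponentLE (ζ(2)) (1 + (C₁ + (31 − S))/(c − (31 − S)))`, `S = savingRate = ∫ φ̃ dψ`, with the PROVED rates of
  `TwoTaleP15Saving` and the PROVED irrationality of `ζ(2) = π²/6` (tree Lindemann: `transcendental_pi_holds`);
* **`zetaTwo_exponent_le_of_inputs`** (PROVED): with `c = 29.10787`, any `0 < C₁ ≤ 42.033616`, and the certified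
  `S ≥ 15.98084`: `ExponentLE (ζ(2)) 5.0496` and hence the tree's record fact `Zudilin2014.zetaTwo_irrationalityExponent_le`
  — AN IMPLICATION ONLY: none of the three inputs is a theorem of the tree, and no measure of `ζ(2)` is claimed.

What is and is not proved about the inputs is tabulated in `families/denom/P15KERNEL.md`.
References: W. Zudilin, arXiv:1310.1526 = Ann. Math. Québec 38 (2014) [Zudilin2014ZetaTwo], Prop. 1, Lemmas 6–8,
Remark 5; M. Hata, Acta Arith. 63 (1993) Remark 2.1 (tree `Hata1993.remark_2_1`).
-/

noncomputable section

open Filter Topology Finset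
open Literature.NumberTheory.Transcendental
open Literature.NumberTheory.Irrationality
open Summit.KontsevichZagierPeriods.Zeta5Search
open Summit.KontsevichZagierPeriods.Zeta5Search.Denom.TwoTaleP15Saving

namespace Summit.KontsevichZagierPeriods.Zeta5Search.Denom.TwoTaleP15Forms

/-! ### Proposition 1 at P15, explicitly -/

/-- Pole coefficients `C_k = (−1)^{d+b₄+k} C(k−b₁,k−a₁) C(k−b₂,k−a₂) C(k−b₃,k−a₃) C(b₄−a₄−1,k−a₄)` at P15
(`(−1)^{d+b₄+k} = (−1)^{42n+1+k} = (−1)^{k+1}`), for `a₄* = 15n+1 ≤ k ≤ b₄ − 1 = 26n+1`. [Zudilin2014ZetaTwo, (C_k) §3] -/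
def coefC (n k : ℕ) : ℤ :=
  (-1) ^ (k + 1) * ((Nat.choose (k - 1) (k - (13 * n + 1)) * Nat.choose (k - (2 * n + 1)) (k - (11 * n + 1)) *
    Nat.choose (k - (4 * n + 1)) (k - (9 * n + 1)) * Nat.choose (11 * n) (k - (15 * n + 1)) : ℕ) : ℤ)

/-- The rational function `R(t)` of §3 at P15, evaluated at an integer `t = m` (not a pole):
`∏_{j≤3} [∏_{i=b_j}^{a_j−1} (m+i)/(a_j−b_j)!] · (b₄−a₄−1)!/∏_{i=a₄}^{b₄−1} (m+i)`. -/
def ratR (n : ℕ) (m : ℤ) : ℚ :=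
  (∏ i ∈ Ico 1 (13 * n + 1), ((m : ℚ) + i)) / (Nat.factorial (13 * n) : ℚ) *
    ((∏ i ∈ Ico (2 * n + 1) (11 * n + 1), ((m : ℚ) + i)) / (Nat.factorial (9 * n) : ℚ)) *
    ((∏ i ∈ Ico (4 * n + 1) (9 * n + 1), ((m : ℚ) + i)) / (Nat.factorial (5 * n) : ℚ)) *
    ((Nat.factorial (11 * n) : ℚ) / ∏ i ∈ Ico (15 * n + 1) (26 * n + 2), ((m : ℚ) + i))

/-- The polynomial part `P(m) = R(m) − Σ_k C_k/(m+k)` at an integer `m` outside the poles. -/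
def polyP (n : ℕ) (m : ℤ) : ℚ :=
  ratR n m - ∑ k ∈ Ico (15 * n + 1) (26 * n + 2), (coefC n k : ℚ) / ((m : ℚ) + k)

/-- Newton coefficients `A_ℓ` of `P` in the basis `P_ℓ(t + a₂*)`, `P_ℓ(t) = C(t−1, ℓ)`:
`A_ℓ = Σ_{i ≤ ℓ} (−1)^{ℓ−i} C(ℓ,i) P(i + 1 − a₂*)`, `a₂* = 11n+1`. -/
def newtonA (n ℓ : ℕ) : ℚ :=
  ∑ i ∈ range (ℓ + 1), (-1 : ℚ) ^ (ℓ - i) * (Nat.choose ℓ i : ℚ) * polyP n ((i : ℤ) - 11 * n)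

/-- **`q_n = (−1)^d Σ_k C_k`** (`d = 16n − 1` odd): the `ζ(2)`-coefficient of Zudilin's form at P15 — an integer. -/
def formQ (n : ℕ) : ℤ := -∑ k ∈ Ico (15 * n + 1) (26 * n + 2), coefC n k

/-- **`p_n = (−1)^d (Σ_k C_k Σ_{ℓ=1}^{k−a₂*} ℓ⁻² − Σ_{ℓ=0}^{d} (−1)^ℓ A_ℓ/(ℓ+1))`**: the rational part at P15. -/
def formP (n : ℕ) : ℚ :=
  -((∑ k ∈ Ico (15 * n + 1) (26 * n + 2), (coefC n k : ℚ) * ∑ l ∈ Icc 1 (k - (11 * n + 1)), 1 / ((l : ℚ) ^ 2)) -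
    ∑ l ∈ range (16 * n), (-1 : ℚ) ^ l * newtonA n l / ((l : ℚ) + 1))

/-- The normaliser `D₁₆ₙ D₁₅ₙ` (`D_m = lcm(1, …, m)`; Prop. 1: `c₁ = 16n`, `c₂ = 15n`). -/
def lcmNormaliser (n : ℕ) : ℕ := Nat.lcmUpto (16 * n) * Nat.lcmUpto (15 * n)

/-- Kernel sanity value: `q₁ = −9923952931816770` (= fam-measure's independent evaluation of Prop. 1). -/
theorem formQ_one : formQ 1 = -9923952931816770 := by
  decide +kernel

/-- Kernel sanity value: `p₁ = −41381969327296379567/2535` (`2535 = 3·5·13²` divides `D₁₆D₁₅`; with `formQ_one`,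
`|q₁ζ(2) − p₁| = e^{−32.745…}`) — pins the transcription of `ratR`/`polyP`/`newtonA`/`formP` in the kernel. -/
theorem formP_one : formP 1 = -41381969327296379567 / 2535 := by
  decide +kernel

/-! ### The three analytic inputs (named, NOT proved here) -/

/-- **INPUT I1 — inclusion.** `Φ̃ₙ ∣ D₁₆ₙD₁₅ₙ qₙ` and `Φ̃ₙ⁻¹ D₁₆ₙD₁₅ₙ pₙ ∈ ℤ` for `n ≥ 1`: Zudilin's Lemma 7 (primes
`p > √(26n)`, `S₄`-digit `φ`), Lemma 8 through the Remark-5 partner (`φ̂`), and the missing-brick statement that the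
`p`-side admits `max(φ, φ̂)` too — for the explicit `Φ̃ₙ = savingProduct n`.  Verified exactly for `n ≤ 8` here
(`check_incl.py`) and `n ≤ 40` by fam-measure/ttrl2; PROVED at program level (fam-tele, 2026-08-21); not a tree theorem. -/
@[conjecture] def Inclusion : Prop :=
  ∀ n : ℕ, 1 ≤ n →
    (∃ B : ℤ, ((lcmNormaliser n : ℕ) : ℤ) * formQ n = (savingProduct n : ℤ) * B) ∧
      ∃ A : ℤ, ((lcmNormaliser n : ℕ) : ℚ) * formP n = (savingProduct n : ℚ) * A

/-- **INPUT I2 — decay** with constant `c`: `|qₙ ζ(2) − pₙ| ≤ e^{−cn}` for all large `n` (Zudilin's Lemma 6 gives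
`lim (1/n) log r_n = −C₀`, model `C₀(P15) = 29.10787127…`; any `c < C₀` is then admissible). Not certified. -/
@[conjecture] def Decay (c : ℝ) : Prop :=
  ∀ᶠ n : ℕ in atTop, |(formQ n : ℝ) * zetaValue 2 - (formP n : ℝ)| ≤ Real.exp (-(c * n))

/-- **INPUT I3 — coefficient rate** `C₁`: `(1/n) log|qₙ| → C₁` (model `C₁(P15) = 42.03361581…`). Not certified. -/
@[conjecture] def CoeffRate (C₁ : ℝ) : Prop :=
  Tendsto (fun n : ℕ => Real.log |(formQ n : ℝ)| / n) atTop (𝓝 C₁)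

/-! ### Irrationality of `ζ(2)` (Lindemann, tree-proved) -/

/-- `ζ(2) ∉ ℚ`: `zetaValue 2 = π²/6` (Mathlib `hasSum_zeta_two`) and `π` is transcendental (tree:
`transcendental_pi_holds`). -/
theorem irrational_zetaValue_two : Irrational (zetaValue 2) := by
  have e : zetaValue 2 = Real.pi ^ 2 / (6 : ℕ) := by
    rw [zetaValue]; exact_mod_cast hasSum_zeta_two.tsum_eq
  rw [e]
  refine Irrational.div_natCast ?_ (by norm_num)
  rintro ⟨q, hq⟩
  have halg : IsAlgebraic ℚ (Real.pi ^ 2) := by rw [← hq]; exact isAlgebraic_algebraMap q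
  exact (transcendental_pi_holds : Transcendental ℚ Real.pi) (halg.of_pow two_pos)

/-! ### Hata's lemma for two-tale normalised forms (abstract, PROVED) -/

/-- **Normalised two-tale forms give a measure (PROVED).**  Integer data `qₙ`, rational `pₙ`, a normaliser `Dₙ`
and a saving `Φₙ` with `Dₙqₙ = ΦₙBₙ`, `Dₙpₙ = ΦₙAₙ` (`Aₙ, Bₙ ∈ ℤ`), decay `|qₙξ − pₙ| ≤ e^{−cn}`, coefficient rate
`(1/n) log|qₙ| → C₁ > 0` and normaliser rate `(1/n) log(Dₙ/Φₙ) → δ < c` with `C₁ + δ > 0`: then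
`μ(ξ) ≤ 1 + (C₁ + δ)/(c − δ)` for irrational `ξ` — Hata's Remark 2.1 (`ExponentLE.of_tendsto_log_coeff`) applied to
`Bₙξ − Aₙ` with the rates `C₁ + δ` and `c − δ − ε`, every `ε > 0`. -/
theorem exponentLE_of_normalisedForms {ξ : ℝ} (hξ : Irrational ξ) {q : ℕ → ℤ} {p : ℕ → ℚ} {D Φ : ℕ → ℕ}
    {A B : ℕ → ℤ} {c C₁ δ : ℝ} (hD : ∀ n, 0 < D n) (hΦ : ∀ n, 0 < Φ n)
    (hB : ∀ n, 1 ≤ n → ((D n : ℕ) : ℤ) * q n = (Φ n : ℤ) * B n)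
    (hA : ∀ n, 1 ≤ n → ((D n : ℕ) : ℚ) * p n = (Φ n : ℚ) * A n)
    (hdec : ∀ᶠ n : ℕ in atTop, |(q n : ℝ) * ξ - (p n : ℝ)| ≤ Real.exp (-(c * n)))
    (hC : Tendsto (fun n : ℕ => Real.log |(q n : ℝ)| / n) atTop (𝓝 C₁))
    (hnorm : Tendsto (fun n : ℕ => Real.log ((D n : ℝ) / Φ n) / n) atTop (𝓝 δ))
    (hδ : δ < c) (hC₀ : 0 < C₁) (hQ : 0 < C₁ + δ) :
    ExponentLE ξ (1 + (C₁ + δ) / (c - δ)) := by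
  have hσ₀ : 0 < c - δ := by linarith
  have hΦpos : ∀ n, (0 : ℝ) < Φ n := fun n => by exact_mod_cast hΦ n
  have hDpos : ∀ n, (0 : ℝ) < D n := fun n => by exact_mod_cast hD n
  -- `qₙ ≠ 0` eventually (since `C₁ > 0`)
  have hqne : ∀ᶠ n : ℕ in atTop, q n ≠ 0 := by
    filter_upwards [hC.eventually (lt_mem_nhds hC₀)] with n hn h0
    simp [h0] at hn
  -- the integer forms as reals
  have eB : ∀ n, 1 ≤ n → (B n : ℝ) = (D n : ℝ) / Φ n * q n := fun n hn => by
    rw [div_mul_eq_mul_div, eq_div_iff (hΦpos n).ne']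
    have h := congrArg (fun z : ℤ => (z : ℝ)) (hB n hn)
    push_cast at h
    linarith
  have eA : ∀ n, 1 ≤ n → (A n : ℝ) = (D n : ℝ) / Φ n * p n := fun n hn => by
    rw [div_mul_eq_mul_div, eq_div_iff (hΦpos n).ne']
    have h := congrArg (fun z : ℚ => (z : ℝ)) (hA n hn)
    push_cast at h
    linarith
  -- (a) the coefficient rate of `Bₙ`
  have hBrate : Tendsto (fun n : ℕ => Real.log |(B n : ℝ)| / n) atTop (𝓝 (C₁ + δ)) := by
    refine (hC.add hnorm).congr' ?_
    filter_upwards [hqne, eventually_ge_atTop 1] with n hq hn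
    have hqpos : 0 < |(q n : ℝ)| := abs_pos.2 (by exact_mod_cast hq)
    rw [eB n hn, abs_mul, abs_of_pos (div_pos (hDpos n) (hΦpos n)),
      Real.log_mul (div_pos (hDpos n) (hΦpos n)).ne' hqpos.ne']
    ring
  -- (b) for every exponent `e > 1 + Q/σ₀` pick `ε` with `1 + Q/(σ₀ − ε) < e`
  intro e he
  have he1 : 0 < e - 1 := by
    have : 0 < (C₁ + δ) / (c - δ) := div_pos hQ hσ₀
    linarith
  have hgap : (C₁ + δ) / (e - 1) < c - δ := by
    rw [div_lt_iff₀ he1]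
    have h := (div_lt_iff₀ hσ₀).1 (by linarith : (C₁ + δ) / (c - δ) < e - 1)
    linarith
  obtain ⟨ε, hε, hεgap⟩ : ∃ ε : ℝ, 0 < ε ∧ (C₁ + δ) / (e - 1) < c - δ - ε :=
    ⟨(c - δ - (C₁ + δ) / (e - 1)) / 2, by linarith, by linarith⟩
  have hσ : 0 < c - δ - ε := lt_trans (div_pos hQ he1) hεgap
  have hlt : 1 + (C₁ + δ) / (c - δ - ε) < e := by
    have h1 : (C₁ + δ) / (c - δ - ε) < e - 1 := by
      rw [div_lt_iff₀ hσ]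
      have h := (div_lt_iff₀ he1).1 hεgap
      linarith
    linarith
  -- the normaliser is eventually `≤ e^{(δ + ε) n}`
  have hDΦ : ∀ᶠ n : ℕ in atTop, (D n : ℝ) / Φ n ≤ Real.exp ((δ + ε) * n) :=
    eventually_le_exp_mul_of_tendsto_log_div (fun n => div_pos (hDpos n) (hΦpos n)) hnorm (by linarith)
  -- decay of the integer forms
  have herr : ∀ᶠ n : ℕ in atTop, |(B n : ℝ) * ξ - A n| ≤ 1 * Real.exp (-((c - δ - ε) * n)) := by
    filter_upwards [hdec, hDΦ, eventually_ge_atTop 1] with n hd hdn hn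
    have eq : (B n : ℝ) * ξ - A n = (D n : ℝ) / Φ n * ((q n : ℝ) * ξ - p n) := by
      rw [eB n hn, eA n hn]; ring
    rw [eq, abs_mul, abs_of_pos (div_pos (hDpos n) (hΦpos n)), one_mul]
    calc (D n : ℝ) / Φ n * |(q n : ℝ) * ξ - p n|
        ≤ Real.exp ((δ + ε) * n) * Real.exp (-(c * n)) :=
          mul_le_mul hdn hd (abs_nonneg _) (Real.exp_pos _).le
      _ = Real.exp (-((c - δ - ε) * n)) := by rw [← Real.exp_add]; ring_nf
  exact ExponentLE.of_tendsto_log_coeff hξ hQ hσ one_pos A B hBrate herr e hlt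

/-! ### The conditional measure at P15 -/

/-- `D₁₆ₙ D₁₅ₙ > 0`. -/
theorem lcmNormaliser_pos (n : ℕ) : 0 < lcmNormaliser n :=
  Nat.mul_pos (Nat.lcmUpto_pos _) (Nat.lcmUpto_pos _)

/-- The normaliser rate at P15: `(1/n) log (D₁₆ₙD₁₅ₙ/Φ̃ₙ) → 31 − S` (`TwoTaleP15Saving.tendsto_log_lcmNormaliser_div`). -/
theorem tendsto_log_lcmNormaliser_div_savingProduct :
    Tendsto (fun n : ℕ => Real.log ((lcmNormaliser n : ℝ) / savingProduct n) / n) atTop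
      (𝓝 (31 - savingRate)) := by
  refine tendsto_log_lcmNormaliser_div.congr fun n => ?_
  simp only [lcmNormaliser, Nat.cast_mul]

/-- **The measure at P15 from the three inputs (PROVED implication).**  With `S = savingRate = ∫ φ̃ dψ`:
`Inclusion`, `Decay c`, `CoeffRate C₁` (`C₁ > 0`) and `31 − S < c` give
`μ(ζ(2)) ≤ 1 + (C₁ + (31 − S))/(c − (31 − S))` in the `ExponentLE` sense (`exponentLE_of_normalisedForms` with
`Dₙ = D₁₆ₙD₁₅ₙ`, `Φₙ = Φ̃ₙ`, `δ = 31 − S`, and `irrational_zetaValue_two`). -/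
theorem exponentLE_of_inputs {c C₁ : ℝ} (hI : Inclusion) (hD : Decay c) (hC : CoeffRate C₁)
    (hc : 31 - savingRate < c) (hC₀ : 0 < C₁) :
    ExponentLE (zetaValue 2) (1 + (C₁ + (31 - savingRate)) / (c - (31 - savingRate))) := by
  choose! B hB using fun n (hn : 1 ≤ n) => (hI n hn).1
  choose! A hA using fun n (hn : 1 ≤ n) => (hI n hn).2
  have hS := savingRate_lt
  exact exponentLE_of_normalisedForms irrational_zetaValue_two lcmNormaliser_pos savingProduct_pos hB hA hD hC
    tendsto_log_lcmNormaliser_div_savingProduct hc hC₀ (by linarith)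

/-- **The P15 measure, numerically (PROVED implication; inputs NOT certified).**  Decay constant `c = 29.10787`
(`< C₀ = 29.10787127`), coefficient rate `0 < C₁ ≤ 42.033616` (`C₁(P15) = 42.03361581`), and the certified
`S ≥ 15.98084` (`savingRate_bounds`) give `μ(ζ(2)) ≤ 5.0496 < 5.09541178` (Zudilin 2014) — so the inputs would imply
the tree's record fact `Zudilin2014.zetaTwo_irrationalityExponent_le` and a new bound.  The model value at P15 with the
exact constants is `5.04952429…`. -/
theorem zetaTwo_exponent_le_of_inputs {C₁ : ℝ} (hI : Inclusion) (hD : Decay 29.10787) (hC : CoeffRate C₁)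
    (hC₀ : 0 < C₁) (hC₁ : C₁ ≤ 42.033616) :
    ExponentLE (zetaValue 2) 5.0496 ∧ Zudilin2014.zetaTwo_irrationalityExponent_le := by
  have hS := savingRate_bounds
  have h := exponentLE_of_inputs hI hD hC (by linarith [hS.1]) hC₀
  have hden : 0 < 29.10787 - (31 - savingRate) := by linarith [hS.1]
  have hle : 1 + (C₁ + (31 - savingRate)) / (29.10787 - (31 - savingRate)) ≤ 5.0496 := by
    have h1 : (C₁ + (31 - savingRate)) / (29.10787 - (31 - savingRate)) ≤ 4.0496 := by
      rw [div_le_iff₀ hden]; nlinarith [hS.1]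
    linarith
  have h' : ExponentLE (zetaValue 2) 5.0496 := h.mono hle
  exact ⟨h', (zetaTwo_record_of_exponentLE h' (by norm_num)).1⟩

end Summit.KontsevichZagierPeriods.Zeta5Search.Denom.TwoTaleP15Forms

end
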